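import Mathlib
import Summits.Schanuel.Schanuel.Theorems.RigidCoreMinimalCounterexampleInAclMatesLocallyFinite

/-!
# Bounded sets of mates are finite, bounding the second coordinate only (stub `stub_matesLocallyFiniteSnd`)

Route `RigidCore`, crux (S*) `MinimalCounterexampleInAcl` (item stmt-Schanuel-0969), line
`kernel-arithmetic-selection` (skeleton gen 19), landed `--supports stmt-Schanuel-0969`.

This is the mirror image (second coordinate) of the landed first-coordinate statement
`stub_matesLocallyFinite` (`…MatesLocallyFinite.lean`), whose coordinate-free helper
`transcendental_coord_of_mem_locusMates` is reused.

Let `x ∈ ℂ²` be a rank-2 first failure (`x ∈ firstFailures 2`) with `x₁` transcendental, and let `y` range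
over the MATES of `x` (`locusMates x`: ℚ-linearly independent tuples `y` such that `(y, e^y)` satisfies every
ℚ-polynomial relation of `(x, eˣ)`).

**Claim.** For every `R`, the mates `y` with `‖y₁‖ ≤ R` form a finite set.

**Proof.**
1. (`MateGrowth.exists_coord_expPoly`, `MateGrowth.expPoly_zeros_finite`) There is a fixed non-zero
   `m₁ ∈ ℚ[T, S]` with `m₁(e^{y₁}, y₁) = 0` for every `y` on the locus, and the zeros of the non-zero
   exponential polynomial `s ↦ m₁(e^s, s)` in the disc `‖s‖ ≤ R` form a finite set `F₁`; so `y ↦ y₁` maps our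
   set into `F₁`.
2. (`exists_mvPolynomial_of_trdeg_lt_two`) Since `trdeg ℚ(x, eˣ) < 2` there is `q ≠ 0` in `ℚ[A, B]` with
   `q(x₀, x₁) = 0`; this relation of `(x, eˣ)` transfers to the locus: `q(y₀, y₁) = 0` for all `y ∈ locusPts x`.
3. (`transcendental_coord_of_mem_locusMates`) `y₁` is transcendental for every mate `y`.
4. (`finite_setOf_aeval_eq_zero`) For transcendental `s` the roots `z` of `q(z, s) = 0` are finitely many, so
   each fibre `{y mate | y₁ = s}` is finite (it injects into that root set via `y ↦ y₀`); fibres over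
   non-values are empty. A finite union of finite fibres over `F₁` is finite.
-/

noncomputable section

set_option linter.dupNamespace false

open Complex Set

namespace Summit.Schanuel.Schanuel.Cruxes.MinimalCounterexampleInAcl.KernelArithmeticSelection

open Literature.NumberTheory.Transcendental.KernelTranslatesRankTwo (finite_setOf_aeval_eq_zero
  exists_mvPolynomial_of_trdeg_lt_two)

/-- **The coordinates of every tuple on the locus of a rank-2 tuple with `trdeg ℚ(x, eˣ) < 2` satisfy a FIXED
non-zero algebraic relation** `q(y₀, y₁) = 0`, `q ∈ ℚ[A, B] ∖ 0` (the relation `q(x₀, x₁) = 0` given by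
`trdeg < 2`, renamed into `ℚ[X, Y]`, lies in the relation ideal of `(x, eˣ)` and transfers to the locus);
second-coordinate companion of `exists_coordRel_locusPts` (variables in the order `(y₀, y₁)`). -/
theorem exists_coordRel_locusPts_snd {x : Fin 2 → ℂ}
    (htr : Algebra.trdeg ℚ ↥(IntermediateField.adjoin ℚ (range x ∪ range (cexp ∘ x))) < (2 : Cardinal)) :
    ∃ q : MvPolynomial (Fin 2) ℚ, q ≠ 0 ∧ ∀ y ∈ locusPts x, MvPolynomial.aeval ![y 0, y 1] q = 0 := by
  obtain ⟨q, hq0, hq⟩ :=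
    exists_mvPolynomial_of_trdeg_lt_two htr (mem_adjoin_self x 0) (mem_adjoin_self x 1)
  refine ⟨q, hq0, fun y hy => ?_⟩
  -- adapted from `exists_coordRel_locusPts` (first-coordinate file)
  have hre : ∀ w : Fin 2 → ℂ, MvPolynomial.aeval (Sum.elim w (cexp ∘ w))
      (MvPolynomial.rename (![Sum.inl 0, Sum.inl 1] : Fin 2 → Fin 2 ⊕ Fin 2) q) =
      MvPolynomial.aeval ![w 0, w 1] q := by
    intro w
    have e : (Sum.elim w (cexp ∘ w) ∘ (![Sum.inl 0, Sum.inl 1] : Fin 2 → Fin 2 ⊕ Fin 2)) = ![w 0, w 1] := by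
      funext j; fin_cases j <;> rfl
    rw [MvPolynomial.aeval_rename, e]
  have h0 : MvPolynomial.aeval (Sum.elim x (cexp ∘ x))
      (MvPolynomial.rename (![Sum.inl 0, Sum.inl 1] : Fin 2 → Fin 2 ⊕ Fin 2) q) = 0 := by
    rw [hre]; exact hq
  have := hy _ h0
  rwa [hre] at this

/-- **Fibres of `y ↦ y₁` on the mates are finite.** For a first failure `x ∈ ℂ²` with `x₁` transcendental and
any `s`, the mates `y` of `x` with `y₁ = s` form a finite set: empty unless `s = y₁` for a mate `y` (then `s`
is transcendental by `transcendental_coord_of_mem_locusMates`), in which case `y ↦ y₀` injects the fibre into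
the finite root set `{z | q(z, s) = 0}` of `exists_coordRel_locusPts_snd`. -/
theorem locusMates_fibre_finite_snd {x : Fin 2 → ℂ} (hx : x ∈ firstFailures 2)
    (hx1 : Transcendental ℚ (x 1)) (s : ℂ) : {y : Fin 2 → ℂ | y ∈ locusMates x ∧ y 1 = s}.Finite := by
  obtain ⟨q, hq0, hq⟩ := exists_coordRel_locusPts_snd hx.2.1
  by_cases hs : ∃ y ∈ locusMates x, y 1 = s
  · obtain ⟨y₀, hy₀, rfl⟩ := hs
    have htr : Transcendental ℚ (y₀ 1) := transcendental_coord_of_mem_locusMates hx hy₀ hx1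
    refine Set.Finite.of_finite_image (f := fun y : Fin 2 → ℂ => y 0)
      ((finite_setOf_aeval_eq_zero hq0 htr).subset ?_) ?_
    · rintro _ ⟨y, ⟨hy, hy1⟩, rfl⟩
      simp only [Set.mem_setOf_eq]
      rw [← hy1]
      exact hq y hy.2
    · intro y hy y' hy' h
      funext j
      fin_cases j
      · exact h
      · exact hy.2.trans hy'.2.symm
  · push Not at hs
    refine Set.finite_empty.subset ?_
    rintro y ⟨hy, hy1⟩
    exact (hs y hy hy1).elim

/-- **Bounded sets of mates are finite, bounding the second coordinate only** (curried form of the stub):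
for a rank-2 first failure `x` with `x₁` transcendental, the mates `y` with `‖y₁‖ ≤ R` are finitely many. -/
theorem locusMates_finite_of_norm_one_le {x : Fin 2 → ℂ} (hx : x ∈ firstFailures 2)
    (hx1 : Transcendental ℚ (x 1)) (R : ℝ) :
    {y : Fin 2 → ℂ | y ∈ locusMates x ∧ ‖y 1‖ ≤ R}.Finite := by
  obtain ⟨m, hm0, hm⟩ := MateGrowth.exists_coord_expPoly hx.2.1 1
  have hF : {s : ℂ | ‖s‖ ≤ R ∧ MvPolynomial.aeval ![cexp s, s] m = 0}.Finite :=
    MateGrowth.expPoly_zeros_finite hm0 R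
  refine (hF.biUnion fun s _ => locusMates_fibre_finite_snd hx hx1 s).subset ?_
  intro y hy
  exact Set.mem_biUnion (x := y 1) ⟨hy.2, hm y hy.1.2⟩ ⟨hy.1, rfl⟩

/-- **Registered stub `stub_matesLocallyFiniteSnd` (PROVED)** — BOUNDED SETS OF MATES ARE FINITE, second
coordinate only (rank 2): for a rank-2 first failure `x` with `x₁` transcendental, the mates `y` with
`‖y₁‖ ≤ R` are finitely many. -/
theorem stub_matesLocallyFiniteSnd : ∀ (x : Fin 2 → ℂ), x ∈ Summit.Schanuel.Schanuel.Cruxes.MinimalCounterexampleInAcl.KernelArithmeticSelection.firstFailures 2 → Transcendental ℚ (x 1) → ∀ R : ℝ, Set.Finite {y : Fin 2 → ℂ | y ∈ Summit.Schanuel.Schanuel.Cruxes.MinimalCounterexampleInAcl.KernelArithmeticSelection.locusMates x ∧ ‖y 1‖ ≤ R} := by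
  intro x hx hx1 R
  exact locusMates_finite_of_norm_one_le hx hx1 R

end Summit.Schanuel.Schanuel.Cruxes.MinimalCounterexampleInAcl.KernelArithmeticSelection

end
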